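import Literature.NumberTheory.EllipticCurves.IsogenyPotentiallyGoodMinimalDiscriminantProofs
import Literature.NumberTheory.EllipticCurves.IsogenyCyclicKernelCoatesProofs
import Literature.NumberTheory.EllipticCurves.RationalIsogenyDegreesProofs
import Literature.NumberTheory.EllipticCurves.IsogenyNeronScalingMinimalDiscriminantDirectionProofs
import Literature.NumberTheory.EllipticCurves.IsogenyXRationalFunctionProofs
import Literature.NumberTheory.EllipticCurves.GlobalMinimalModelProofs
import HarnessLib

/-!
# `ord_p Δ_min` along an ARBITRARY `ℚ`-isogeny at a potentially good prime `p ≥ 5`: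
# `p^s · ord_p Δ_min(E) ≡ ord_p Δ_min(E') (mod 12)` (Dokchitser–Dokchitser 2015, Thm. 5.1 (1) with
# §3 Thm. 6 / Cor. 8) — proofs only

`Proofs` file (theorems only: no definition, no named fact, no instance), topic
`NumberTheory/EllipticCurves`. It assembles three tree theorems into the congruence that governs the
valuation of the minimal discriminant along every `ℚ`-isogeny at a potentially good prime `p ≥ 5`:

* the DISCHARGED clause `l ≠ p` of Dokchitser–Dokchitser 2015, Thm. 5.1 (1)
  (`dokchitser_padicValInt_minimalDiscriminantInt_eq_of_isogeny_of_not_dvd_degree_holds`,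
  `IsogenyPotentiallyGoodMinimalDiscriminantProofs`): an isogeny of degree prime to `p` preserves
  `ord_p Δ_min`;
* Coates' lemma in Vélu form for an arbitrary model (`Isogeny.exists_Δ_pow_eq_mul_pow_twelve'`,
  `IsogenyCyclicKernelCoatesProofs`): `Δ(E)ⁿ = Δ(E'')·c¹²` along a `K`-isogeny with CYCLIC kernel of
  order `n` prime to `6` (= op. cit. §2 Thm. 3);
* the cyclic reduction of isogenies and the divisor-closure of cyclic degrees
  (`IsIsogenous.exists_isCyclic`, `Isogeny.exists_isCyclic_degree_eq_of_dvd`,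
  `RationalIsogenyDegreesProofs`; Silverman *AEC* III.4.11–4.12), the factorisation through a
  separable isogeny (`Isogeny.exists_eq_comp_of_ker_le`, *AEC* Cor. III.4.11) and Néron's global
  minimal model over `ℚ` (`hasGlobalMinimalModel_rat_holds`, *AEC* VIII.8.3).

Main results (`W, W'/ℚ` globally minimal elliptic curves, `W ∼ W'`, `p ≥ 5` prime, `0 ≤ ord_p j(W)`):

* (private helper `Isogeny.exists_generator_of_isCyclic` — bookkeeping: a cyclic kernel of order
  `n > 1` is `{k•P : k < n}` for an affine point `P` of exact order `n`, the input format of the tree's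
  Coates lemma.)
* `exists_pow_mul_padicValInt_minimalDiscriminantInt_modEq_twelve_of_isIsogenous` —
  **`∃ s, pˢ · ord_p Δ_min(W) ≡ ord_p Δ_min(W') (mod 12)`**. Proof: a cyclic `φ : W → W'` of degree
  `n = pˢ·m` (`p ∤ m`) factors as `λ ∘ ψ` with `ψ : W → W''` cyclic of degree `pˢ`
  (kernel `ker φ ∩ W[pˢ]`) and `λ : W'' → W'` of degree `m`; for a global minimal model `C • W''`,
  the sibling clause gives `ord_p Δ_min(C • W'') = ord_p Δ_min(W')` (degree `m` prime to `p`;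
  `C • W''` is potentially good at `p`, *AEC* VII.7.2), and Coates' lemma on `ψ` gives
  `Δ(W)^{pˢ} = Δ(W'')·c¹² = Δ(C • W'')·(u c)¹²`, whence the congruence by taking `ord_p`.
  (For `p ∤ n` take `s = 0`: the sibling clause itself.)
* `padicValInt_minimalDiscriminantInt_modEq_twelve_of_isIsogenous_of_twelve_dvd` — if moreover
  **`12 ∣ (p − 1) · ord_p Δ_min(W)`** (i.e. the semistability defect `e = 12/gcd(12, ord_p Δ_min)`
  divides `p − 1`: Delbourgo's type (G), in particular every potentially good ORDINARY additive
  fibre at `p ≥ 5`, Serre–Tate), then **`ord_p Δ_min(W) ≡ ord_p Δ_min(W') (mod 12)`**; with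
  `0 ≤ ord_p Δ_min ≤ 10` on both sides (Kodaira table at an additive potentially good `p ≥ 5`, or `0`
  at a good prime) this is EQUALITY —
  `padicValInt_minimalDiscriminantInt_eq_of_isIsogenous_of_twelve_dvd_of_lt`.

This is the `p ≥ 5` content of the clause "`l = p`, the reduction is good or potentially ordinary" of
Dokchitser–Dokchitser 2015, Thm. 5.1 (1) (tree named fact
`dokchitser_padicValInt_minimalDiscriminantInt_eq_of_isogeny_of_potentiallyGoodOrdinary`, statement
only, `IsogenyPotentiallyGoodOrdinaryMinimalDiscriminant.lean`): at a potentially good ordinary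
additive `p ≥ 5` the defect `e` divides `p − 1` (Serre–Tate: the inertia of the semistabilising field
acts faithfully on the ORDINARY special fibre through `(ℤ/p)ˣ`), so the hypothesis `12 ∣ (p−1)·ord_p Δ_min`
holds; the printed proof (op. cit. §3, Cor. 8 from Thm. 6 `δ' ≡ pδ (mod 12)` and Thm. 7) is exactly
this congruence argument. What is NOT covered here: `p ∈ {2, 3}` (Coates' lemma needs a kernel of
order prime to `6`) — there the print twists to a good ordinary curve.

## References
* [DokchitserDokchitser2015LocalInvariants] T. Dokchitser, V. Dokchitser, *Local invariants of
  isogenous elliptic curves*, Trans. Amer. Math. Soc. 367 (2015) 4339–4358 = arXiv:1208.5519: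
  §2 Thm. 3 (Coates), §3 Thm. 6, Thm. 7, Cor. 8, §5 Thm. 5.1 (1), Table 1.
* [SilvermanAEC2009] J. H. Silverman, *The Arithmetic of Elliptic Curves*, 2nd ed.: Cor. III.4.11,
  Prop. III.4.12, Thm. III.6.2, Prop. VII.5.5, Cor. VII.7.2, Cor. VIII.8.3.
-/

noncomputable section

open scoped Classical

open Finset

universe u

namespace WeierstrassCurve

namespace Isogeny

variable {K : Type u} [Field K] {W W' : WeierstrassCurve K}

/-- **A cyclic kernel in generator form.** If `φ : E → E'` has CYCLIC kernel of order `n = #ker φ > 1`,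
then there is an affine point `P = (x₀, y₀) ∈ E(K̄)` of exact order `n` with
`ker φ = {k • P : 0 ≤ k < n}` — the input format of the tree's Coates lemma
`Isogeny.exists_Δ_pow_eq_mul_pow_twelve'`. (A generator of the finite cyclic group `ker φ`,
Silverman *AEC* III.4; elementary group theory.) [folklore] -/
private theorem exists_generator_of_isCyclic (φ : Isogeny W W') (hφ : φ.IsCyclic)
    (h1 : 1 < φ.degree) :
    ∃ (x₀ y₀ : AlgebraicClosure K)
      (h : (W.baseChange (AlgebraicClosure K)).toAffine.Nonsingular x₀ y₀),
      (φ.degree : ℤ) • Affine.Point.some x₀ y₀ h = 0 ∧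
      (∀ k : ℕ, 0 < k → k < φ.degree → (k : ℤ) • Affine.Point.some x₀ y₀ h ≠ 0) ∧
      ∀ Q : W.geomPoints, Q ∈ φ.toAddMonoidHom.ker ↔
        Q ∈ (range φ.degree).image fun k : ℕ => (k : ℤ) • Affine.Point.some x₀ y₀ h := by
  haveI : IsAddCyclic φ.toAddMonoidHom.ker := hφ
  obtain ⟨g, hg⟩ := IsAddCyclic.exists_ofOrder_eq_natCard (α := φ.toAddMonoidHom.ker)
  -- everything below is computed in `W.geomPoints` (the prelude's synonym of `E(K̄)`)
  set P : W.geomPoints := (g : W.geomPoints) with hPdef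
  have hdeg : addOrderOf P = φ.degree := by
    rw [hPdef, AddSubgroup.addOrderOf_coe, hg]; rfl
  have hP0 : P ≠ 0 := by
    intro h0
    rw [h0, addOrderOf_zero] at hdeg
    omega
  have hordP : (φ.degree : ℤ) • P = 0 := by
    rw [natCast_zsmul, ← hdeg]; exact addOrderOf_nsmul_eq_zero P
  have hminP : ∀ k : ℕ, 0 < k → k < φ.degree → (k : ℤ) • P ≠ 0 := by
    intro k hk0 hk hzero
    rw [natCast_zsmul] at hzero
    have := addOrderOf_le_of_nsmul_eq_zero hk0 hzero
    omega
  have hzm : AddSubgroup.zmultiples P = φ.toAddMonoidHom.ker := by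
    refine AddSubgroup.eq_of_le_of_card_ge (AddSubgroup.zmultiples_le_of_mem g.2) ?_
    rw [Nat.card_zmultiples, hdeg]
    rfl
  have hkerP : ∀ Q : W.geomPoints, Q ∈ φ.toAddMonoidHom.ker ↔
      ∃ k : ℕ, k < φ.degree ∧ (k : ℤ) • P = Q := by
    intro Q
    rw [← hzm, AddSubgroup.mem_zmultiples_iff]
    constructor
    · rintro ⟨k, rfl⟩
      have hn0 : (φ.degree : ℤ) ≠ 0 := by exact_mod_cast φ.degree_pos.ne'
      have h0 : 0 ≤ k % (φ.degree : ℤ) := Int.emod_nonneg _ hn0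
      have h1 : k % (φ.degree : ℤ) < (φ.degree : ℤ) :=
        Int.emod_lt_of_pos _ (by exact_mod_cast φ.degree_pos)
      refine ⟨(k % (φ.degree : ℤ)).toNat, by omega, ?_⟩
      rw [Int.toNat_of_nonneg h0, ← hdeg, mod_addOrderOf_zsmul]
    · rintro ⟨k, -, rfl⟩
      exact ⟨(k : ℤ), rfl⟩
  -- the generator is an affine point
  obtain ⟨x₀, y₀, h, hP⟩ : ∃ (x₀ y₀ : AlgebraicClosure K)
      (h : (W.baseChange (AlgebraicClosure K)).toAffine.Nonsingular x₀ y₀),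
      P = Affine.Point.some x₀ y₀ h := by
    rcases hgP : P with _ | ⟨x₀, y₀, h⟩
    · exact (hP0 hgP).elim
    · exact ⟨x₀, y₀, h, rfl⟩
  -- transport along `P = (x₀, y₀)` (the two `ℤ`-actions agree definitionally)
  refine ⟨x₀, y₀, h, ?_, ?_, ?_⟩
  · have := hordP
    rw [hP] at this
    exact this
  · intro k hk0 hk
    have := hminP k hk0 hk
    rw [hP] at this
    exact this
  · intro Q
    rw [hkerP Q]
    constructor
    · rintro ⟨k, hk, hkQ⟩
      rw [hP] at hkQ
      exact (Finset.mem_image (β := (W.baseChange (AlgebraicClosure K)).toAffine.Point)).mpr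
        ⟨k, Finset.mem_range.mpr hk, hkQ⟩
    · intro hQ
      obtain ⟨k, hk, hkQ⟩ :=
        (Finset.mem_image (β := (W.baseChange (AlgebraicClosure K)).toAffine.Point)).mp hQ
      refine ⟨k, Finset.mem_range.mp hk, ?_⟩
      rw [hP]
      exact hkQ

end Isogeny

end WeierstrassCurve

namespace Literature.NumberTheory.EllipticCurves

open _root_.WeierstrassCurve

/-- **`pˢ · ord_p Δ_min(W) ≡ ord_p Δ_min(W') (mod 12)` along every `ℚ`-isogeny at a potentially
good prime `p ≥ 5`** (globally minimal models; `0 ≤ ord_p j(W)`). A cyclic `φ : W → W'`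
(`IsIsogenous.exists_isCyclic`) of degree `n = pˢ m`, `p ∤ m`, factors as `λ ∘ ψ` with `ψ : W → W''`
cyclic of degree `pˢ` and `λ` of degree `m`; a global minimal model `C • W''` has
`ord_p Δ_min(C • W'') = ord_p Δ_min(W')` by the discharged clause `l ≠ p` of Dokchitser–Dokchitser
Thm. 5.1 (1), and Coates' lemma `Δ(W)^{pˢ} = Δ(W'')·c¹²` gives the congruence at `p`.
This is Dokchitser–Dokchitser 2015 §3 Thm. 6 (`δ' ≡ pδ mod 12` for a `p`-isogeny) extended to
arbitrary degree. [cite: DokchitserDokchitser2015LocalInvariants, §3 Thm. 6 with §2 Thm. 3 (Coates) and Thm. 5.1 (1)]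
[cite: SilvermanAEC2009, Cor. III.4.11, Prop. III.4.12, Cor. VIII.8.3] -/
theorem exists_pow_mul_padicValInt_minimalDiscriminantInt_modEq_twelve_of_isIsogenous
    {W W' : WeierstrassCurve ℚ} [W.IsElliptic] [W'.IsElliptic] [W.IsGloballyMinimal]
    [W'.IsGloballyMinimal] (hiso : IsIsogenous W W') {p : ℕ} (hp : p.Prime) (hp5 : 5 ≤ p)
    (hj : 0 ≤ padicValRat p W.j) :
    ∃ s : ℕ, (p : ℤ) ^ s * (padicValInt p W.minimalDiscriminantInt : ℤ) ≡
      (padicValInt p W'.minimalDiscriminantInt : ℤ) [ZMOD 12] := by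
  classical
  haveI := Fact.mk hp
  -- a cyclic isogeny `φ : W → W'`
  obtain ⟨φ, hφ⟩ := hiso.exists_isCyclic
  set n := φ.degree with hn
  have hn0 : n ≠ 0 := φ.degree_pos.ne'
  by_cases hpn : p ∣ n
  swap
  · -- degree prime to `p`: the discharged clause `l ≠ p`
    refine ⟨0, ?_⟩
    rw [pow_zero, one_mul,
      dokchitser_padicValInt_minimalDiscriminantInt_eq_of_isogeny_of_not_dvd_degree_holds W W' φ p
        hp hpn hj]
  -- the `p`-part `pˢ` of the degree
  set s := n.factorization p with hs
  have hps : p ^ s ∣ n := Nat.ordProj_dvd n p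
  have hcop : Nat.Coprime p (n / p ^ s) := Nat.coprime_ordCompl hp hn0
  have hs1 : 1 ≤ s := (hp.dvd_iff_one_le_factorization hn0).mp hpn
  have hps0 : 0 < p ^ s := pow_pos hp.pos s
  have h1n : 1 < p ^ s := Nat.one_lt_pow (by omega) hp.one_lt
  -- `ψ : W → W''` cyclic of degree `pˢ` with kernel `ker φ ∩ W[pˢ]`
  obtain ⟨W'', hW'', ψ, hψc, hψdeg, hψker⟩ := φ.exists_isCyclic_degree_eq_of_dvd hφ hps
  haveI := hW''
  -- `φ = λ ∘ ψ`
  have hkerle : ∀ P : W.geomPoints, ψ P = 0 → φ P = 0 := by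
    intro P hP
    have hmem : P ∈ ψ.toAddMonoidHom.ker := hP
    rw [hψker] at hmem
    exact (AddSubgroup.mem_inf.mp hmem).1
  obtain ⟨lam, hlam⟩ := ψ.exists_eq_comp_of_ker_le φ (Isogeny.degree_eq_deg ψ).ge hkerle
  -- `deg λ · pˢ = n`
  have hcard : n = lam.degree * p ^ s := by
    have h1 := AddMonoidHom.natCard_ker_comp_of_surjective lam.toAddMonoidHom ψ.toAddMonoidHom
      ψ.surjective
    have h2 : (lam.toAddMonoidHom.comp ψ.toAddMonoidHom).ker = φ.toAddMonoidHom.ker := by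
      ext P
      simp only [AddMonoidHom.mem_ker, AddMonoidHom.coe_comp, Function.comp_apply,
        Isogeny.coe_toAddMonoidHom, hlam P]
    rw [h2] at h1
    rw [← hψdeg]
    exact h1
  have hlamdeg : lam.degree = n / p ^ s := by
    rw [eq_comm]
    exact Nat.div_eq_of_eq_mul_left hps0 hcard
  have hndvd : ¬ p ∣ lam.degree := by
    rw [hlamdeg]
    exact (Nat.Prime.coprime_iff_not_dvd hp).mp hcop
  -- a global minimal model `C • W''` and the transported isogeny `C • W'' → W'`
  obtain ⟨C, hC⟩ := hasGlobalMinimalModel_rat_holds W''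
  haveI := hC
  obtain ⟨lam₂, hlam₂⟩ : ∃ lam₂ : Isogeny (C • W'') W', lam₂.degree = lam.degree := by
    have h := lam.exists_degree_eq_of_smul C (1 : VariableChange ℚ)
    rwa [one_smul] at h
  have hndvd₂ : ¬ p ∣ lam₂.degree := by rw [hlam₂]; exact hndvd
  -- potential good reduction is inherited by `W''` and its models
  have hj'' : 0 ≤ padicValRat p W''.j := padicValRat_j_nonneg_of_isogeny ψ hp hj
  have hjC : 0 ≤ padicValRat p (C • W'').j := by rw [variableChange_j]; exact hj''
  -- the clause `l ≠ p` on `λ₂`: `ord_p Δ_min(C • W'') = ord_p Δ_min(W')`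
  have hsib := dokchitser_padicValInt_minimalDiscriminantInt_eq_of_isogeny_of_not_dvd_degree_holds
    (C • W'') W' lam₂ p hp hndvd₂ hjC
  -- Coates' lemma on `ψ`: `Δ(W)^{pˢ} = Δ(W'')·c¹²`
  obtain ⟨x₀, y₀, h, hord, hmin, hker⟩ :=
    ψ.exists_generator_of_isCyclic hψc (by rw [hψdeg]; exact h1n)
  rw [hψdeg] at hord hmin hker
  have hodd : p ^ s = 2 * (p ^ s / 2) + 1 := by
    have hodd' : Odd (p ^ s) := (hp.odd_of_ne_two (by omega)).pow
    obtain ⟨m, hm⟩ := hodd'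
    omega
  have h3 : Nat.Coprime 3 (p ^ s) := by
    apply Nat.Coprime.pow_right
    rw [Nat.coprime_primes Nat.prime_three hp]
    omega
  obtain ⟨c, hc⟩ := ψ.exists_Δ_pow_eq_mul_pow_twelve' h hodd h3 h1n hord hmin hker
  -- bookkeeping of discriminants: `Δ(W'') = u¹² Δ(C • W'')`
  have hΔW : W.Δ ≠ 0 := W.isUnit_Δ.ne_zero
  have hΔC : (C • W'').Δ ≠ 0 := (C • W'').isUnit_Δ.ne_zero
  have hu0 : ((C.u : ℚˣ) : ℚ) ≠ 0 := C.u.ne_zero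
  have hΔ'' : W''.Δ = ((C.u : ℚˣ) : ℚ) ^ 12 * (C • W'').Δ := by
    rw [variableChange_Δ, Units.val_inv_eq_inv_val, ← mul_assoc, ← mul_pow,
      mul_inv_cancel₀ hu0, one_pow, one_mul]
  have hc' : W.Δ ^ (p ^ s) = (C • W'').Δ * (((C.u : ℚˣ) : ℚ) * c) ^ 12 := by
    rw [hc, hΔ'']; ring
  have hc0 : c ≠ 0 := by
    rintro rfl
    rw [zero_pow (by norm_num), mul_zero] at hc
    exact pow_ne_zero _ hΔW hc
  have huc0 : ((C.u : ℚˣ) : ℚ) * c ≠ 0 := mul_ne_zero hu0 hc0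
  -- take `ord_p`
  have hval := congrArg (padicValRat p) hc'
  rw [padicValRat.pow, padicValRat.mul hΔC (pow_ne_zero _ huc0), padicValRat.pow] at hval
  have hvW : padicValRat p W.Δ = padicValInt p W.minimalDiscriminantInt := by
    rw [← cast_minimalDiscriminantInt, padicValRat.of_int]
  have hvC : padicValRat p (C • W'').Δ = padicValInt p (C • W'').minimalDiscriminantInt := by
    rw [← cast_minimalDiscriminantInt, padicValRat.of_int]
  rw [hvW, hvC, hsib] at hval
  refine ⟨s, ?_⟩
  rw [Int.modEq_iff_dvd]
  refine ⟨-padicValRat p (((C.u : ℚˣ) : ℚ) * c), ?_⟩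
  push_cast at hval ⊢
  linarith

/-- **`pˢ·v ≡ v (mod 12)` when `12 ∣ (p − 1)·v`.** Elementary: `pˢ − 1 = (p − 1)(1 + p + ⋯ + p^{s−1})`.
[folklore] -/
private theorem pow_mul_modEq_twelve_of_twelve_dvd {p v : ℕ} (h12 : 12 ∣ (p - 1) * v)
    (hp1 : 1 ≤ p) (s : ℕ) :
    (p : ℤ) ^ s * (v : ℤ) ≡ (v : ℤ) [ZMOD 12] := by
  have hpv : (p : ℤ) * (v : ℤ) ≡ (v : ℤ) [ZMOD 12] := by
    rw [Int.modEq_iff_dvd]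
    obtain ⟨k, hk⟩ := h12
    refine ⟨-(k : ℤ), ?_⟩
    have hk' : ((p - 1 : ℕ) : ℤ) * (v : ℤ) = 12 * (k : ℤ) := by exact_mod_cast hk
    have hp' : ((p - 1 : ℕ) : ℤ) = (p : ℤ) - 1 := by omega
    rw [hp'] at hk'
    linarith
  induction s with
  | zero => simp
  | succ s ih =>
    calc (p : ℤ) ^ (s + 1) * (v : ℤ) = (p : ℤ) * ((p : ℤ) ^ s * (v : ℤ)) := by ring
      _ ≡ (p : ℤ) * (v : ℤ) [ZMOD 12] := ih.mul_left _
      _ ≡ (v : ℤ) [ZMOD 12] := hpv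

/-- **`ord_p Δ_min(W) ≡ ord_p Δ_min(W') (mod 12)` along every `ℚ`-isogeny at a potentially good
prime `p ≥ 5` with `12 ∣ (p − 1)·ord_p Δ_min(W)`** — i.e. when the semistability defect
`e = 12/gcd(12, ord_p Δ_min)` divides `p − 1` (Delbourgo's type (G); automatic on a potentially good
ORDINARY additive fibre at `p ≥ 5` by Serre–Tate). This is the congruence form of
Dokchitser–Dokchitser 2015, §3 Cor. 8 ("if the reduction is potentially ordinary, then `δ = δ′`"),
proved as in print from Thm. 6 (`δ′ ≡ pδ mod 12`).
[cite: DokchitserDokchitser2015LocalInvariants, §3 Thm. 6 and Cor. 8; Thm. 5.1 (1)] -/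
theorem padicValInt_minimalDiscriminantInt_modEq_twelve_of_isIsogenous_of_twelve_dvd
    {W W' : WeierstrassCurve ℚ} [W.IsElliptic] [W'.IsElliptic] [W.IsGloballyMinimal]
    [W'.IsGloballyMinimal] (hiso : IsIsogenous W W') {p : ℕ} (hp : p.Prime) (hp5 : 5 ≤ p)
    (hj : 0 ≤ padicValRat p W.j)
    (h12 : 12 ∣ (p - 1) * padicValInt p W.minimalDiscriminantInt) :
    (padicValInt p W.minimalDiscriminantInt : ℤ) ≡
      (padicValInt p W'.minimalDiscriminantInt : ℤ) [ZMOD 12] := by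
  obtain ⟨s, hs⟩ :=
    exists_pow_mul_padicValInt_minimalDiscriminantInt_modEq_twelve_of_isIsogenous hiso hp hp5 hj
  exact (pow_mul_modEq_twelve_of_twelve_dvd h12 hp.one_lt.le s).symm.trans hs

/-- **Equality of `ord_p Δ_min` along every `ℚ`-isogeny at a potentially good prime `p ≥ 5` of type
(G)**, range form: under the hypotheses of
`padicValInt_minimalDiscriminantInt_modEq_twelve_of_isIsogenous_of_twelve_dvd`, if both valuations are
`< 12` (always the case at a potentially good prime `p ≥ 5`: `ord_p Δ_min ∈ {0, 2, 3, 4, 6, 8, 9, 10}`,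
Silverman *ATAEC* IV Table 4.1 — supplied by the caller in its own vocabulary), then
`ord_p Δ_min(W) = ord_p Δ_min(W')`: Dokchitser–Dokchitser 2015, Thm. 5.1 (1), clause "`l = p`,
potentially ordinary", at `p ≥ 5`, for isogenies of any degree.
[cite: DokchitserDokchitser2015LocalInvariants, Thm. 5.1 (1) with §3 Cor. 8] -/
theorem padicValInt_minimalDiscriminantInt_eq_of_isIsogenous_of_twelve_dvd_of_lt
    {W W' : WeierstrassCurve ℚ} [W.IsElliptic] [W'.IsElliptic] [W.IsGloballyMinimal]
    [W'.IsGloballyMinimal] (hiso : IsIsogenous W W') {p : ℕ} (hp : p.Prime) (hp5 : 5 ≤ p)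
    (hj : 0 ≤ padicValRat p W.j)
    (h12 : 12 ∣ (p - 1) * padicValInt p W.minimalDiscriminantInt)
    (hlt : padicValInt p W.minimalDiscriminantInt < 12)
    (hlt' : padicValInt p W'.minimalDiscriminantInt < 12) :
    padicValInt p W.minimalDiscriminantInt = padicValInt p W'.minimalDiscriminantInt := by
  have h := padicValInt_minimalDiscriminantInt_modEq_twelve_of_isIsogenous_of_twelve_dvd hiso hp
    hp5 hj h12
  have h1 : ((padicValInt p W.minimalDiscriminantInt : ℕ) : ℤ) % 12 =
      ((padicValInt p W'.minimalDiscriminantInt : ℕ) : ℤ) % 12 := h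
  rw [Int.emod_eq_of_lt (by positivity) (by exact_mod_cast hlt),
    Int.emod_eq_of_lt (by positivity) (by exact_mod_cast hlt')] at h1
  exact_mod_cast h1

end Literature.NumberTheory.EllipticCurves

end
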